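import Summits.CriticalPhenomena.PercolationContinuityZ3.Theorems.Transplant.FKConnectivityAllQTwoTree
import Summits.CriticalPhenomena.PercolationContinuityZ3.Theorems.Transplant.FKConnectivityAllQK4
import HarnessLib

/-!
# Connectivity correlation inequalities for `φ_{w,q}`, every `q > 0` — file 9k: APEX-GROWN EDGE SETS; negative association and the hub
# inequality on every edge set grown from a `K₄` by apex steps (`0 < q ≤ 1`)

Support file (`--supports stmt-CriticalPhenomena-4575`), FK sub-lane `prim-bschramm-fk-1` (gen 5) of the post-continuity
programme; builds on p205010 (kernel theorem, internal audit signed; external expert review pending).  One definition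
(`IsApexGrown S T`: `T` is obtained from the seed `S` by apex steps `T ↦ T ∪ {ux, xv}`, `uv ∈ T`, `x` fresh; `IsTwoTree` is the case
`S = {uv}`); no named facts, no sorries; standard axioms.

* `edgeNegCorrSupp_of_isApexGrown` — negative association (`0 < q ≤ 1`, all weight vectors supported in the set) propagates from a
  loopless seed along apex steps (= `edgeNegCorr_supp_apex_step`, iterated): the class of negatively associated supports is closed
  under 2-sums with triangles.
* **`edgeNegCorrSupp_of_K4Grown`** — seed `K₄` (`edgeNegCorr_supp_K4`, the kernel certificate of Sokal's computation): every
  `φ_{w,q}`, `0 < q ≤ 1`, supported in an edge set grown from a `K₄` is edge-negatively associated — supports beyond the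
  series–parallel class of Wagner 2008; **`hubUnder_of_K4Grown`** — hence ALR (13) there for every `q ∈ (0,1)`.
[cite: Wagner2006, Ex. 5.1, Thm. 5.8(d), §5.3] [cite: AyyerLinussonRavichandran2025, §7 eq. (13), Conj. 7.1 (p. 22)]
[cite: Grimmett2006, §3.9 eq. (3.94), Conj. (3.96) (pp. 63–64)]
-/

noncomputable section

namespace Summit.CriticalPhenomena.PercolationContinuityZ3.Theorems

namespace FK

open MeasureTheory Set Literature.Probability.LatticeModels Literature.Probability.Percolation
open Literature.Probability.Percolation.DecisionTree (ind ind_of_mem ind_of_not_mem ind_nonneg)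
open scoped Classical symmDiff

variable {V : Type*} [Fintype V]

/-! ### Edge sets grown by apex steps from a seed; negative association on everything grown from `K₄` -/

/-- **Apex-grown edge sets**: `T` is obtained from the seed `S` by repeatedly choosing a pair `uv` already present and a fresh
vertex `x` and adding `ux, xv` (2-sums with triangles at the vertex level).  `IsTwoTree T` is the case `S = {uv}`.
[cite: Wagner2006, Thm. 5.8(d), §5.3] -/
inductive IsApexGrown (S : Set (Sym2 V)) : Set (Sym2 V) → Prop
  | seed : IsApexGrown S S
  | cons {T : Set (Sym2 V)} {u v x : V} (hT : IsApexGrown S T) (huv : s(u, v) ∈ T) (hx : ∀ e ∈ T, x ∉ e) :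
      IsApexGrown S (T ∪ {s(u, x), s(x, v)})

omit [Fintype V] in
/-- Apex steps preserve looplessness. [folklore] -/
theorem IsApexGrown.not_isDiag {S T : Set (Sym2 V)} (hT : IsApexGrown S T) (hS : ∀ e ∈ S, ¬ e.IsDiag) {e : Sym2 V}
    (he : e ∈ T) : ¬ e.IsDiag := by
  induction hT generalizing e with
  | seed => exact hS e he
  | @cons T u v x hT' huvT hx ih =>
    rcases he with he | he
    · exact ih he
    · have hxu : x ≠ u := fun h => hx _ huvT (h ▸ Sym2.mem_mk_left u v)
      have hxv : x ≠ v := fun h => hx _ huvT (h ▸ Sym2.mem_mk_right u v)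
      rcases he with rfl | rfl
      · rw [Sym2.mk_isDiag_iff]; exact hxu.symm
      · rw [Sym2.mk_isDiag_iff]; exact hxv

/-- **Negative association propagates along apex steps** (`0 < q ≤ 1`): if every weight vector supported in the loopless seed `S`
is edge-negatively associated, so is every weight vector supported in any edge set grown from `S` by apex steps — the class of
'negatively associated supports' is closed under 2-sums with triangles. [cite: Wagner2006, Thm. 5.8(d), §5.3]
[cite: Grimmett2006, §3.9 eq. (3.94) (pp. 63–64)] -/
theorem edgeNegCorrSupp_of_isApexGrown {q : ℝ} (hq0 : 0 < q) (hq1 : q ≤ 1) {S T : Set (Sym2 V)} (hS : ∀ e ∈ S, ¬ e.IsDiag)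
    (hNC : EdgeNegCorrSupp S q) (hT : IsApexGrown S T) : EdgeNegCorrSupp T q := by
  rcases hq1.lt_or_eq with hlt | rfl
  · induction hT with
    | seed => exact hNC
    | cons hT' huvT hx ih => exact edgeNegCorr_supp_apex_step hq0 hlt (fun e he => hT'.not_isDiag hS he) huvT hx ih
  · intro w _ e f _ hfe
    exact negCorr_of_q_one w e f hfe

/-- **Negative association on every edge set grown from a `K₄` by apex steps** (`0 < q ≤ 1`, all weights): the seed is
`edgeNegCorr_supp_K4` (Sokal's `K₄` computation, certified in `…AllQK4.lean`), the steps are `edgeNegCorr_supp_apex_step`.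
These supports are not series–parallel (they contain `K₄`), so this goes beyond Wagner's class.
[cite: Wagner2006, Ex. 5.1, Thm. 5.8(d)] [cite: Grimmett2006, §3.9 eq. (3.94), Conj. (3.96) (pp. 63–64)] -/
theorem edgeNegCorrSupp_of_K4Grown {q : ℝ} (hq0 : 0 < q) (hq1 : q ≤ 1) {x y z t : V} (hxy : x ≠ y) (hxz : x ≠ z) (hxt : x ≠ t)
    (hyz : y ≠ z) (hyt : y ≠ t) (hzt : z ≠ t) {T : Set (Sym2 V)}
    (hT : IsApexGrown ({s(x, y), s(x, z), s(x, t), s(y, z), s(y, t), s(z, t)} : Set (Sym2 V)) T) : EdgeNegCorrSupp T q := by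
  refine edgeNegCorrSupp_of_isApexGrown hq0 hq1 ?_ (edgeNegCorr_supp_K4 hq0 hq1 hxy hxz hxt hyz hyt hzt) hT
  intro e he
  simp only [Set.mem_insert_iff, Set.mem_singleton_iff] at he
  rcases he with rfl | rfl | rfl | rfl | rfl | rfl <;> rw [Sym2.mk_isDiag_iff]
  exacts [hxy, hxz, hxt, hyz, hyt, hzt]

/-- **The hub inequality (ALR 2025, (13)) on every edge set grown from `K₄` by apex steps**, every `q ∈ (0,1)`, all weights supported
in it. [cite: AyyerLinussonRavichandran2025, §7 eq. (13), Conj. 7.1 (p. 22)] [cite: Wagner2006, Ex. 5.1] -/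
theorem hubUnder_of_K4Grown {q : ℝ} (hq0 : 0 < q) (hq1 : q < 1) {x y z t : V} (hxy : x ≠ y) (hxz : x ≠ z) (hxt : x ≠ t)
    (hyz : y ≠ z) (hyt : y ≠ t) (hzt : z ≠ t) {T : Set (Sym2 V)}
    (hT : IsApexGrown ({s(x, y), s(x, z), s(x, t), s(y, z), s(y, t), s(z, t)} : Set (Sym2 V)) T)
    {o a b : V} (hoa : s(o, a) ∈ T) (hba : s(b, a) ∈ T) (w : Sym2 V → unitInterval)
    (hw : ∀ e, ((w e : unitInterval) : ℝ) ≠ 0 → e ∈ T) : HubUnder (rcMeasureW w q ∅) o a b :=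
  hubUnder_of_edgeNegCorr_on hq0 hq1 T (edgeNegCorrSupp_of_K4Grown hq0 hq1.le hxy hxz hxt hyz hyt hzt hT) o a b hoa hba w hw

end FK

end Summit.CriticalPhenomena.PercolationContinuityZ3.Theorems

end
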